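import Literature.Barriers.CriticalPhenomena.PlaquetteWalkHoleRootKillForcedZeroWitness
import Literature.Barriers.CriticalPhenomena.PlaquetteWalkHoleRootStructuralKillQuadrant
import HarnessLib

/-!
# Barrier catalogue (SAWScalingLimit): the EAST QUADRANT form of the structural `K_S1` / `K_N2` kills — the east pair
of the corner-kill table at every boundary position, and a closed zero in a box wider than the kill column

Leaf of `PlaquetteWalkHoleRootKillForcedZeroWitness` (→ `PlaquetteWalkHoleRootPrefixLoop` → the STRUCTURAL KILL parent)
and of `PlaquetteWalkHoleRootStructuralKillQuadrant` (the lane's quadrant parity count, there for the WEST pair). The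
east-wall form of the `K_S1` / `K_N2` kills (`PlaquetteWalkHoleRootPrefixLoop` §5) assumes, besides the hole and the
kill cell, that the cell east of the eastern pocket is absent and that the root row's line is uncrossable further east —
i.e. that the kill column `w.1 + 1` is the box's east wall. In the venture lane's corner-kill table (LAW L) twelve of the
33 observed kills are east kills on the BOTTOM or TOP wall of a box wider than that (frames `75a`, `75c`, `66a`, `66c`,
`76a`, `85a`, `85b`). This file removes every hypothesis east of column `w.1 + 1`.

* §1–§2 the SOUTH-EASTERN QUADRANT `{x ≥ w.1 + 1, y ≤ w.2 − 1}` (`InQuadSE`; top edges = the eastern ray of the hole from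
  `m = 1` on, `isTopEdgeSE_iff`; west edges = the `E` sides of the root plaquette's column below the row) and its parity
  count in the style of the quadrant leaf: ★★ `ΩG.cross_root_S_or_exists_nth_isWestEdgeSE` — a class-`B2a` walk at the far
  cell whose excursion polygon winds around the root EITHER crosses `w.S` OR crosses a west edge of the quadrant
  (boundary crossings even, `even_card_changes_iff`; top crossings = the ray count minus the `w.S` crossing; ray count odd
  by `AJ_root_ne_zero_iff_odd_rayCountAt`); ★★ `ΩG.cross_root_S_or_exists_nth_eq_rootS_E` — with `K_S1` absent and no
  western door of column `w.1 + 1` below the kill row, that west edge is `rootS.E`.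
* §3 ★★★ `ΩG.exists_prefix_nth_eq_root_S_of_cross_rootS_E` — THE SEPARATION LEMMA, SHARP FORM: an excursion through
  `rootS.E` forces the PREFIX through `w.S` (the argument of `PlaquetteWalkHoleRootPrefixLoop` §4 with the lower corner of
  the root edge joined to `J` down the side `rootS.E` itself, an excursion edge, hence off the prefix loop; nothing east
  of column `w.1 + 1` is used).
* §4 ★★ `ΩG.kindsIn_rootS_eq_of_prefix_cross_of_cross_rootS_E` — prefix through `w.S` + excursion through `rootS.E` ⇒
  `kindsIn (rootS w) = [corner, corner]` (side bookkeeping only; no kill cell).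
* §5 ★★★ `ΩG.kindsIn_rootS_or_root_eq_of_AJ_ne_zero_under_quadrant`, ★★★★ `ΩG.not_W1FreeOff_farW_of_wound_under_quadrant` /
  `ΩG.under_w1_killed_of_killSE_quadrant` — hole, `K_S1`, no western door of column `w.1 + 1` below the kill row ⇒ EVERY
  wound under-walk is `w₁`-marked; the row-mirror twins ★★★★ `ΩG.not_W2FreeOff_farW_of_wound_over_quadrant` /
  `ΩG.over_w2_killed_of_killNE_quadrant` (`K_N2`, no western door above the kill row; transport by `ΩG.mirrorFar`);
  ★★★★ `vertexFunctional_printed_farCellW_exists_eq_zero_Ioo_of_east_kills_quadrant` — the eastern kill-forced zero with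
  both kills theorems and NOTHING assumed east of column `w.1 + 1`. With the quadrant leaf (west pair, every boundary
  position) and `PlaquetteWalkHoleRootPrefixLoop` (east pair at the east wall), every row of the lane's LAW L is now a
  theorem schema at every boundary position of its kill cell, up to the two free witnesses.
* §6 ★★★★ `vertexFunctional_printed_wideEastKillDom_exists_eq_zero` — a CLOSED zero in the lane's frame `75a` made asymmetric,
  `7×5 ∖ {(3,2),(5,0),(5,4),(0,0)}` (31 faces; a live column east of the kill cells), with the kernel-certified witnesses
  `underMids` / `overMids` of the witness leaf redrawn in this domain. No hypothesis.

Scope: venture lane «pcv-sawmu», HOME `FINDING-YB-KILL-FORCED-ZEROS.md` §5 (LAW L, frames) and §12; seat b-step0 gen 25.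
Not in print; elementary given the parent files. The private plumbing of `YangBaxterSAWGeneralDomain`,
`YangBaxterSAWExcursionJordan` and `PlaquetteWalkHoleRootPrefixLoop` is read via `open private … from`.

References: A. Glazman, I. Manolescu, arXiv:1708.00395v3, §1 (Fig. 1, Fig. 2, the remark after eq. (1)), §2.1, §4.2 and
Lemma 2.1 [GlazmanManolescu2019]; A. Glazman, Electron. Commun. Probab. 20 (2015) no. 86, Lemma 3.1, proof pp. 6–7
[Glazman2015WeightedSAW]; R. Courant, H. Robbins, *What is Mathematics?* (1941/1958), Ch. V Appendix §2 (the even–odd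
rule) [CourantRobbins1958]; L. V. Ahlfors, *Complex Analysis*, 3rd ed. (1979), Ch. 4 §2.1 [AhlforsCA1979];
H. Duminil-Copin, S. Smirnov, Ann. of Math. 175 (2012), Lemma 1 [DuminilCopinSmirnov2012].
-/

noncomputable section

open Set Function Complex

namespace Literature.Probability.RandomPlanarGeometry.SAW.YangBaxter

open Real
open Literature.Barriers.CriticalPhenomena.PlaquetteWalk (mirrorRow mirrorRowFace mirrorSide mirrorKind mirrorArc
  mirrorRow_side arcsOf_map_mirrorRow arcKind_mirrorSide mirrorRowFace_mirrorRowFace mirrorSide_mirrorSide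
  mirrorKind_mirrorKind)

open private fc_fh fc_ne rev_snd_nth from Literature.Probability.RandomPlanarGeometry.YangBaxterSAWGeneralDomain
open private side_jOut segment_pJ_even sideSeg_coords_E eq_side_of_mem_crossSeg_sideSeg not_mem_sideSeg_of_mem_arcSeg
  toC_midPt_side_mem_sideSeg
  from Literature.Probability.RandomPlanarGeometry.YangBaxterSAWExcursionJordan
open private fSeg_coords hSeg_coords not_mem_sideSeg_N_of_mem_fSeg_hSeg not_mem_sideSeg_S_of_mem_fSeg_hSeg toC_midPt_mem_crossSeg
  from Literature.Barriers.CriticalPhenomena.PlaquetteWalkHoleRootPrefixLoop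

/-! ## §1 The south-eastern quadrant of the root plaquette and its boundary edges -/

section QuadrantCellsSE

variable (w : Face)

/-- The south-eastern quadrant: the cells east of the root plaquette's column and below the root row.
[cite: CourantRobbins1958, Ch. V Appendix §2 (The Jordan Curve Theorem for Polygons: the even–odd rule)] -/
def InQuadSE (c : Face) : Prop := w.1 + 1 ≤ c.1 ∧ c.2 ≤ w.2 - 1

/-- The top edges of the south-eastern quadrant: the bottom line of the root row east of the root plaquette.
[cite: CourantRobbins1958, Ch. V Appendix §2 (the even–odd rule)] -/
def IsTopEdgeSE : MidEdge → Prop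
  | .slant x y => w.1 + 1 ≤ x ∧ y = w.2
  | .vert _ _ => False

/-- The west edges of the south-eastern quadrant: the east sides of the root plaquette's column below the root row.
[cite: CourantRobbins1958, Ch. V Appendix §2 (the even–odd rule)] -/
def IsWestEdgeSE : MidEdge → Prop
  | .vert x y => x = w.1 + 1 ∧ y ≤ w.2 - 1
  | .slant _ _ => False

/-- **Crossing the boundary of the south-eastern quadrant**: two distinct faces sharing the mid-edge `e` lie on different
sides of it iff `e` is a top or a west edge. [cite: CourantRobbins1958, Ch. V Appendix §2 (the even–odd rule)] -/
theorem quadrantSE_change_iff {e : MidEdge} {F₁ F₂ : Face} (h₁ : ∃ s, F₁.side s = e) (h₂ : ∃ s, F₂.side s = e)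
    (hne : F₁ ≠ F₂) : ¬(InQuadSE w F₁ ↔ InQuadSE w F₂) ↔ (IsTopEdgeSE w e ∨ IsWestEdgeSE w e) := by
  rcases (Face.exists_side_eq_iff F₁ e).1 h₁ with e₁ | e₁ <;> rcases (Face.exists_side_eq_iff F₂ e).1 h₂ with e₂ | e₂
  · exact absurd (e₁.trans e₂.symm) hne
  · subst e₁; subst e₂
    cases e <;> simp only [MidEdge.faces, InQuadSE, IsTopEdgeSE, IsWestEdgeSE, or_false, false_or] <;> omega
  · subst e₁; subst e₂
    cases e <;> simp only [MidEdge.faces, InQuadSE, IsTopEdgeSE, IsWestEdgeSE, or_false, false_or] <;> omega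
  · exact absurd (e₁.trans e₂.symm) hne

/-- A top edge is not a west edge. [cite: CourantRobbins1958, Ch. V Appendix §2 (the even–odd rule)] -/
theorem not_isTopEdgeSE_and_isWestEdgeSE (e : MidEdge) : ¬(IsTopEdgeSE w e ∧ IsWestEdgeSE w e) := by
  cases e <;> simp [IsTopEdgeSE, IsWestEdgeSE]

/-- The top edges are the edges `m ≥ 1` of the eastern ray of the hole. [cite: CourantRobbins1958, Ch. V Appendix §2 (the even–odd rule)] -/
theorem isTopEdgeSE_iff (e : MidEdge) : IsTopEdgeSE w e ↔ ∃ m : ℕ, 1 ≤ m ∧ e = rayMid (holeFaceW w) .E m := by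
  constructor
  · intro h
    cases e with
    | vert x y => exact absurd h (by simp [IsTopEdgeSE])
    | slant x y =>
      simp only [IsTopEdgeSE] at h
      refine ⟨(x - w.1).toNat, by omega, ?_⟩
      rw [rayMid_holeFaceW_E_eq]
      congr 1 <;> omega
  · rintro ⟨m, hm, rfl⟩
    rw [rayMid_holeFaceW_E_eq]
    simp only [IsTopEdgeSE, and_true]
    omega

/-- A face next to the far cell other than the far cell is outside the south-eastern quadrant.
[cite: GlazmanManolescu2019, §1 (the lattice of rhombi and its mid-edges)] -/
theorem not_inQuadSE_of_side_farW {F : Face} {s t : Side} (h : F.side s = (farW w).side t) (hne : F ≠ farW w) :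
    ¬InQuadSE w F := by
  rcases (Face.exists_side_eq_iff F ((farW w).side t)).1 ⟨s, h⟩ with e | e <;>
    obtain ⟨k, j⟩ := w <;> cases t <;>
      simp only [farW, Face.side, MidEdge.faces, InQuadSE] at e hne ⊢ <;>
      (subst e; first | (exact absurd rfl hne) | (simp only [not_and, not_le]; omega))

end QuadrantCellsSE

/-! ## §2 The parity count on the south-eastern quadrant -/

namespace ΩG

variable {D : Set Face} {w : Face}

/-- ★★ **THE SOUTH-EASTERN QUADRANT PARITY LEMMA.** For a class-`B2a` walk at the far cell whose excursion polygon
winds around the root, EITHER the excursion crosses the bottom side of the root plaquette OR it crosses a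
WEST edge of the south-eastern quadrant — the `E` side of some cell `(w.1, y)`, `y ≤ w.2 − 1`, of the root plaquette's
column — at some interior index. (Boundary crossings of the quadrant are even; its top crossings are the eastern ray
count minus the crossing of `w.S`, and the ray count is odd.)
[cite: CourantRobbins1958, Ch. V Appendix §2 (The Jordan Curve Theorem for Polygons: the even–odd rule)]
[cite: Glazman2015WeightedSAW, Lemma 3.1 (proof, pp. 6–7: the classes of walks through a rhombus)] -/
theorem cross_root_S_or_exists_nth_isWestEdgeSE
    (ω : ΩG D (w.side .W) (farW w)) (hr : RootedFace D (w.side .W) (farW w)) (h : ω.IsB2a)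
    (hA : ω.AJ hr h (toC (midPt (w.side .W))) ≠ 0) :
    (∃ i, ω.2.firstHitG ≤ i ∧ i < ω.2.arcs.length ∧ ω.2.nth (i + 1) = w.side .S) ∨
      ∃ k, ω.2.firstHitG + 2 ≤ k ∧ k ≤ ω.2.arcs.length - 1 ∧ IsWestEdgeSE w (ω.2.nth k) := by
  classical
  have hodd := (ω.AJ_root_ne_zero_iff_odd_rayCountAt (hr := hr) h (b := holeFaceW w) (τ := .E)
    (holeFaceW_side_E w)).1 hA
  have hF := ω.fh_lt h
  have hB2 : ω.2.firstHitG + 1 < ω.2.arcs.length := h.1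
  set F := ω.2.firstHitG with hFdef
  set n := ω.2.arcs.length with hndef
  by_cases hcross : ∃ i, F ≤ i ∧ i < n ∧ ω.2.nth (i + 1) = w.side .S
  · exact Or.inl hcross
  right
  push Not at hcross
  -- the membership sequence and the index range `(F+1, n-1]`
  let b : ℕ → Bool := fun k => decide (InQuadSE w (ω.2.fc k))
  have hbF : b (F + 1) = false := by
    have hin := (ω.2.side_sIn_nth (i := F + 1) hB2).1
    rw [(ω.2.exitSide_specG hr hF).1] at hin
    have hne : ω.2.fc (F + 1) ≠ farW w := fc_ne ω hr h (by omega) hB2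
    simp only [b, decide_eq_false_iff_not]
    exact not_inQuadSE_of_side_farW w hin hne
  have hbL : b (n - 1) = false := by
    have hout := (ω.2.side_sIn_nth (i := n - 1) (by omega)).2.1
    rw [show n - 1 + 1 = n by omega, ω.2.nth_length] at hout
    have hne : ω.2.fc (n - 1) ≠ farW w := fc_ne ω hr h (by omega) (by omega)
    simp only [b, decide_eq_false_iff_not]
    exact not_inQuadSE_of_side_farW w hout hne
  have heven := (even_card_changes_iff b (F + 1) (n - 1) (by omega)).2 (hbF.trans hbL.symm)
  have hchg : ∀ k ∈ Finset.Ioc (F + 1) (n - 1),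
      (b (k - 1) ≠ b k ↔ IsTopEdgeSE w (ω.2.nth k) ∨ IsWestEdgeSE w (ω.2.nth k)) := by
    intro k hk
    rw [Finset.mem_Ioc] at hk
    have hout := (ω.2.side_sIn_nth (i := k - 1) (by omega)).2.1
    have hin := (ω.2.side_sIn_nth (i := k) (by omega)).1
    rw [show k - 1 + 1 = k by omega] at hout
    have hne : ω.2.fc (k - 1) ≠ ω.2.fc (k - 1 + 1) := YBWalk.fc_succ_ne (by omega)
    rw [show k - 1 + 1 = k by omega] at hne
    have key := quadrantSE_change_iff w ⟨_, hout⟩ ⟨_, hin⟩ hne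
    simp only [b, ne_eq, decide_eq_decide]
    exact key
  set K := Finset.Ioc (F + 1) (n - 1) with hKdef
  set T := K.filter fun k => IsTopEdgeSE w (ω.2.nth k) with hTdef
  set E := K.filter fun k => IsWestEdgeSE w (ω.2.nth k) with hEdef
  have hsplit : (K.filter fun k => b (k - 1) ≠ b k) = T ∪ E := by
    ext k
    simp only [hTdef, hEdef, Finset.mem_union, Finset.mem_filter]
    constructor
    · rintro ⟨hk, hb⟩
      rcases (hchg k hk).1 hb with ht | he
      · exact Or.inl ⟨hk, ht⟩
      · exact Or.inr ⟨hk, he⟩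
    · rintro (⟨hk, ht⟩ | ⟨hk, he⟩)
      · exact ⟨hk, (hchg k hk).2 (Or.inl ht)⟩
      · exact ⟨hk, (hchg k hk).2 (Or.inr he)⟩
  have hdisj : Disjoint T E := by
    rw [Finset.disjoint_filter]
    intro k _ ht he
    exact not_isTopEdgeSE_and_isWestEdgeSE w _ ⟨ht, he⟩
  rw [hsplit, Finset.card_union_of_disjoint hdisj] at heven
  -- the top crossings are the eastern ray count (the edge `m = 0`, `w.S`, is not crossed): odd
  have hT : T.card = ω.rayCountAt hr h (holeFaceW w) .E := by
    unfold ΩG.rayCountAt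
    have hexit : ∀ j < ω.Mv, (ω.jFace h j).side (ω.jOut hr h j) = ω.2.nth (F + j + 1) :=
      fun j hj => side_jOut (hr := hr) h hj
    have hFM : F + ω.Mv = n := by unfold ΩG.Mv; omega
    symm
    refine Finset.card_bij' (fun j _ => F + j + 1) (fun k _ => k - F - 1) ?_ ?_ ?_ ?_
    · intro j hj
      rw [Finset.mem_filter, Finset.mem_range] at hj
      obtain ⟨hjM, m, hm⟩ := hj
      rw [hexit j hjM] at hm
      -- `m ≥ 1`: the edge `m = 0` is `w.S`, excluded
      have hm1 : 1 ≤ m := by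
        by_contra hlt
        have hm0 : m = 0 := by omega
        rw [hm0, ← root_side_S_eq_rayMid] at hm
        exact hcross (F + j) (by omega) (by omega) hm
      have hlt : F + j + 1 ≤ n - 1 ∧ F + 2 ≤ F + j + 1 := by
        have h1 : F + j + 1 ≠ n := by
          intro e
          rw [e, ω.2.nth_length, rayMid_holeFaceW_E_eq] at hm
          exact farW_side_ne_slant_east w ω.1 m hm
        have h2 : j ≠ 0 := by
          rintro rfl
          rw [Nat.add_zero, (ω.2.exitSide_specG hr hF).1, rayMid_holeFaceW_E_eq] at hm
          exact farW_side_ne_slant_east w _ m hm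
        omega
      rw [hTdef, Finset.mem_filter, hKdef, Finset.mem_Ioc]
      exact ⟨⟨by omega, hlt.1⟩, (isTopEdgeSE_iff w _).2 ⟨m, hm1, hm⟩⟩
    · intro k hk
      rw [hTdef, Finset.mem_filter, hKdef, Finset.mem_Ioc] at hk
      obtain ⟨⟨hk1, hk2⟩, ht⟩ := hk
      obtain ⟨m, -, hm⟩ := (isTopEdgeSE_iff w _).1 ht
      rw [Finset.mem_filter, Finset.mem_range]
      refine ⟨by omega, m, ?_⟩
      rw [hexit _ (by omega), show F + (k - F - 1) + 1 = k by omega]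
      exact hm
    · intro j hj; omega
    · intro k hk
      rw [hTdef, Finset.mem_filter, hKdef, Finset.mem_Ioc] at hk
      omega
  rw [hT] at heven
  have hEodd : Odd E.card := by
    rcases Nat.even_or_odd E.card with he | he
    · exact absurd heven (Nat.not_even_iff_odd.2 (hodd.add_even he))
    · exact he
  obtain ⟨k, hk⟩ := Finset.card_pos.1 hEodd.pos
  rw [hEdef, Finset.mem_filter, hKdef, Finset.mem_Ioc] at hk
  exact ⟨k, by omega, hk.1.2, hk.2⟩

/-- ★★ **With the kill cell `K_S1` absent and no western door of the column east of the root plaquette below the kill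
row, the west crossing is the `E` side of the cell below the root plaquette.** [cite: CourantRobbins1958, Ch. V Appendix §2 (the even–odd rule)]
[cite: Glazman2015WeightedSAW, Lemma 3.1 (proof, pp. 6–7: the classes of walks through a rhombus)] -/
theorem cross_root_S_or_exists_nth_eq_rootS_E (hK : killSE w ∉ D)
    (hcol : ∀ y : ℤ, y ≤ w.2 - 3 → (w.1, y) ∉ D ∨ (w.1 + 1, y) ∉ D)
    (ω : ΩG D (w.side .W) (farW w)) (hr : RootedFace D (w.side .W) (farW w)) (h : ω.IsB2a)
    (hA : ω.AJ hr h (toC (midPt (w.side .W))) ≠ 0) :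
    (∃ i, ω.2.firstHitG ≤ i ∧ i < ω.2.arcs.length ∧ ω.2.nth (i + 1) = w.side .S) ∨
      ∃ i, ω.2.firstHitG ≤ i ∧ i < ω.2.arcs.length ∧ ω.2.nth (i + 1) = (rootS w).side .E := by
  rcases ω.cross_root_S_or_exists_nth_isWestEdgeSE hr h hA with hc | ⟨k, hk1, hk2, he⟩
  · exact Or.inl hc
  right
  have hF := ω.fh_lt h
  cases hnth : ω.2.nth k with
  | slant x y => rw [hnth] at he; exact absurd he (by simp [IsWestEdgeSE])
  | vert x y =>
    rw [hnth] at he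
    simp only [IsWestEdgeSE] at he
    obtain ⟨hx, hy⟩ := he
    subst hx
    have hdoor := ω.2.door_nth (j := k) (by omega) (by omega)
    rw [hnth] at hdoor
    simp only [MidEdge.faces, add_sub_cancel_right] at hdoor
    have hy1 : y = w.2 - 1 := by
      rcases lt_or_eq_of_le hy with hlt | heq
      · exfalso
        rcases lt_or_eq_of_le (show y ≤ w.2 - 2 by omega) with hlt2 | heq2
        · rcases hcol y (by omega) with hc | hc
          · exact hc hdoor.1
          · exact hc hdoor.2
        · apply hK
          have e : killSE w = (w.1 + 1, y) := by rw [heq2]; rfl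
          rw [e]; exact hdoor.2
      · exact heq
    refine ⟨k - 1, by omega, by omega, ?_⟩
    rw [show k - 1 + 1 = k by omega, hnth, hy1]
    obtain ⟨a, c⟩ := w; simp [rootS, Face.side]

/-! ## §3 The separation lemma, sharper form: an excursion through the east side of the cell below the root plaquette
forces the prefix through the bottom side of the root plaquette -/

/-- The two segments through the hole miss the closed east side of the cell below the root plaquette. [cite: CourantRobbins1958, Ch. V Appendix §2 (the even–odd rule)] -/
theorem not_mem_sideSeg_rootS_E_of_mem_fSeg_hSeg {q : ℂ} (hq : q ∈ fSeg w ∨ q ∈ hSeg w) :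
    q ∉ sideSeg (rootS w) .E := by
  intro hq'
  obtain ⟨hx, -, -⟩ := sideSeg_coords_E hq'
  simp only [rootS] at hx
  rcases hq with hq | hq
  · obtain ⟨t, -, ht1, hx', -⟩ := fSeg_coords w hq
    rw [hx'] at hx; linarith
  · obtain ⟨-, -, hx'⟩ := hSeg_coords w hq
    rw [hx] at hx'; linarith

/-- ★★★ **THE PREFIX-LOOP SEPARATION LEMMA, SHARP FORM.** Hole absent; a class-`B2a` UNDER-walk at the far cell whose
excursion polygon crosses the `E` side of the cell below the root plaquette (the `W` side of the eastern pocket). Then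
the PREFIX crosses the bottom side of the root plaquette (`nth i = w.side S`, `1 ≤ i < firstHitG`). Same winding
argument as `ΩG.exists_prefix_nth_eq_root_S`, the lower corner of the root edge being joined to `J` at the midpoint of
that `E` side down the side itself — an excursion edge, hence off the prefix loop — instead of along the bottom side of
the cell east of the root plaquette; so NOTHING east of column `w.1 + 1` enters.
[cite: CourantRobbins1958, Ch. V Appendix §2 (The Jordan Curve Theorem for Polygons: the even–odd rule)]
[cite: AhlforsCA1979, Ch. 4 §2.1 (index of a point with respect to a closed curve)]
[cite: Glazman2015WeightedSAW, Lemma 3.1 (proof, pp. 6–7: the classes of walks through a rhombus)] -/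
theorem exists_prefix_nth_eq_root_S_of_cross_rootS_E (hh : holeFaceW w ∉ D) (hr : RootedFace D (w.side .W) (farW w))
    (ω : ΩG D (w.side .W) (farW w)) (h : ω.IsB2a) (hS : ω.2.firstSideG = .S)
    (hJ : ∃ j, j < ω.Mv ∧ (ω.jFace h j).side (ω.jOut hr h j) = (rootS w).side .E) :
    ∃ i, 1 ≤ i ∧ i < ω.2.firstHitG ∧ ω.2.nth i = w.side .S := by
  have hM := ω.three_le_Mv hr h
  have hF := ω.fh_lt h
  have h1 := ω.one_le_firstHitG_far
  have hlen : ω.2.arcs.length = ω.2.firstHitG + ω.Mv := by unfold ΩG.Mv; omega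
  set F := ω.2.firstHitG with hFdef
  set n := ω.2.arcs.length with hndef
  have hnthF : ω.2.nth F = (farW w).side .S := by rw [hFdef, ω.2.nth_firstHitG, hS]
  by_contra hP
  push Not at hP
  have hP' : ∀ i, 1 ≤ i → i ≤ F → ω.2.nth i ≠ w.side .S := by
    intro i hi1 hiF e
    rcases Nat.lt_or_ge i F with hl | hl
    · exact hP i hi1 hl e
    · have ei : i = F := by omega
      rw [ei, hnthF] at e
      exact farW_side_ne_rootS_side w .S .N (e.trans (root_side_S_eq_rootS_side_N w))
  obtain ⟨j, hj, hje⟩ := hJ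
  set q1 : ℂ := toC ((holeFaceW w).base + Side.N.endA) with hq1
  set mN : ℂ := toC (midPt ((farW w).side .N)) with hmN
  set q2 : ℂ := toC ((rootS w).base + Side.E.endB) with hq2
  set mE : ℂ := toC (midPt ((rootS w).side .E)) with hmE
  -- P1: the top side of the hole
  have hP1 : segment ℝ (cHi w) q1 = sideSeg (holeFaceW w) .N := by
    rw [segment_symm, sideSeg, cHi]
    congr 2
    obtain ⟨a, b⟩ := w; simp [holeFaceW, Face.base, Side.endB]; ring
  have w1 : ω.windC (cHi w) = ω.windC q1 := by
    refine windC_eq_of_segment fun z hz k hk hzk => ?_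
    rw [hP1] at hz
    obtain ⟨i, hi1, hiF, e⟩ := exists_nth_eq_of_mem_pCedge_sideSeg hh h hS hk hzk hz
      (fun q hq => not_mem_sideSeg_N_of_mem_fSeg_hSeg (by simp [holeFaceW]) hq)
    have hd := ω.2.door_nth (j := i) (by omega) (by omega)
    rw [e] at hd
    have : ((holeFaceW w).side .N).faces.1 = holeFaceW w := by
      obtain ⟨a, b⟩ := w; simp [holeFaceW, Face.side, MidEdge.faces]
    rw [this] at hd
    exact hh hd.1
  -- P2: the right half of the top side of the far cell
  have hP2 : segment ℝ q1 mN ⊆ sideSeg (farW w) .N := by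
    refine (convex_segment _ _).segment_subset ?_ (toC_midPt_side_mem_sideSeg _ _)
    have e : q1 = toC ((farW w).base + Side.N.endB) := by
      rw [hq1]; congr 1; obtain ⟨a, b⟩ := w; simp [holeFaceW, farW, Face.base, Side.endA, Side.endB]; ring
    rw [e]; exact right_mem_segment _ _ _
  have w2 : ω.windC q1 = ω.windC mN := by
    refine windC_eq_of_segment fun z hz k hk hzk => ?_
    obtain ⟨i, hi1, hiF, e⟩ := exists_nth_eq_of_mem_pCedge_sideSeg hh h hS hk hzk (hP2 hz)
      (fun q hq => not_mem_sideSeg_N_of_mem_fSeg_hSeg (by simp [farW]) hq)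
    have hle := firstHitG_le_of_nth_eq (ω := ω) (by omega) e
    have ei : i = F := by omega
    rw [ei, hnthF] at e
    exact absurd (Face.side_injective (farW w) e) (by decide)
  -- P3: the bottom side of the root plaquette (its right end is the top of `rootS.E`)
  have hP3 : segment ℝ (cLo w) q2 = sideSeg w .S := by
    have e1 : cLo w = toC (w.base + Side.S.endA) := rfl
    have e2 : q2 = toC (w.base + Side.S.endB) := by
      rw [hq2]; congr 1; obtain ⟨a, b⟩ := w; simp [rootS, Face.base, Side.endB]; ring
    rw [e1, e2, sideSeg]
  have w3 : ω.windC (cLo w) = ω.windC q2 := by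
    refine windC_eq_of_segment fun z hz k hk hzk => ?_
    rw [hP3] at hz
    obtain ⟨i, hi1, hiF, e⟩ := exists_nth_eq_of_mem_pCedge_sideSeg hh h hS hk hzk hz
      (fun q hq => not_mem_sideSeg_S_of_mem_fSeg_hSeg rfl le_rfl hq)
    exact hP' i hi1 hiF e
  -- P4: DOWN the upper half of the east side of the cell below the root plaquette — an excursion edge
  have hP4 : segment ℝ q2 mE ⊆ sideSeg (rootS w) .E :=
    (convex_segment _ _).segment_subset (right_mem_segment _ _ _) (toC_midPt_side_mem_sideSeg _ _)
  have w4 : ω.windC q2 = ω.windC mE := by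
    refine windC_eq_of_segment fun z hz k hk hzk => ?_
    obtain ⟨i, hi1, hiF, e⟩ := exists_nth_eq_of_mem_pCedge_sideSeg hh h hS hk hzk (hP4 hz)
      (fun q hq => not_mem_sideSeg_rootS_E_of_mem_fSeg_hSeg hq)
    rw [← hje, side_jOut (hr := hr) h hj] at e
    have := ω.2.nth_inj (by omega) (by omega) e
    omega
  -- the two midpoints lie on `J`
  obtain ⟨j₀, hj₀, hj₀e⟩ := exists_jOut_eq_farW_N hh hr h hS
  have wN : ω.windC mN = ω.windC (ω.pJ hr h 0) := by
    refine windC_pJ_edge hh hr h hS (k := 2 * j₀) (by omega) ?_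
    rw [segment_pJ_even h hj₀, hj₀e]
    exact toC_midPt_mem_crossSeg _
  have wE : ω.windC mE = ω.windC (ω.pJ hr h 0) := by
    refine windC_pJ_edge hh hr h hS (k := 2 * j) (by omega) ?_
    rw [segment_pJ_even h hj, hje]
    exact toC_midPt_mem_crossSeg _
  have := windC_jump hh h hS
  rw [w1, w2, wN, ← wE, ← w4, ← w3, sub_self] at this
  exact zero_ne_one this

/-! ## §4 The double θ-corner below the root plaquette -/

/-- A face having the mid-edge `e` as a side is one of the two faces of `e`. [cite: GlazmanManolescu2019, §1 (the lattice of rhombi and its mid-edges)] -/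
private theorem face_of_side_eqQ {F : Face} {s : Side} {e : MidEdge} (h : F.side s = e) : F = e.faces.1 ∨ F = e.faces.2 :=
  (Face.exists_side_eq_iff F e).1 ⟨s, h⟩

/-- Side bookkeeping: an arc with an `N` end and an arc with an `E` end in one rhombus, with four distinct ends and
neither straight, are the two `θ`-corner arcs. [cite: GlazmanManolescu2019, §1, Fig. 1] -/
private theorem corner_corner_of_N_of_E' : ∀ {x y s t : Side}, x ≠ y → y ≠ x.opp → s ≠ t → t ≠ s.opp → s ≠ x →
    s ≠ y → t ≠ x → t ≠ y → (x = .N ∨ y = .N) → (s = .E ∨ t = .E) →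
      arcKind x y = .corner ∧ arcKind s t = .corner := by
  decide

/-- Faces of the `E` side of the cell below the root plaquette: that cell and the eastern pocket. [cite: GlazmanManolescu2019, §1 (the lattice of rhombi and its mid-edges)] -/
private theorem rootS_side_E_faces_pocketSE (w : Face) : ((rootS w).side .E).faces = (rootS w, pocketSE w) := by
  obtain ⟨k, j⟩ := w; simp [rootS, pocketSE, Face.side, MidEdge.faces]

/-- ★★ **THE DOUBLE θ-CORNER BELOW THE ROOT PLAQUETTE from a prefix crossing of `w.S` and an excursion crossing of
`rootS.E`.** No kill cell is needed for this step: the prefix arc through `w.S = rootS.N` has an `N` end in `rootS w`,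
the excursion arc through `rootS.E` an `E` end there, and two arcs of one rhombus with an `N` and an `E` end among four
distinct ends, neither straight, are its two `θ`-corners. [cite: GlazmanManolescu2019, §1, Fig. 1 (two arcs at the two θ-corners weigh w₁)]
[cite: Glazman2015WeightedSAW, Lemma 3.1 (proof, pp. 6–7: the classes of walks through a rhombus)] -/
theorem kindsIn_rootS_eq_of_prefix_cross_of_cross_rootS_E (ω : ΩG D (w.side .W) (farW w))
    (hr : RootedFace D (w.side .W) (farW w)) (h : ω.IsB2a)
    (hpre : ∃ i, 1 ≤ i ∧ i < ω.2.firstHitG ∧ ω.2.nth i = w.side .S)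
    (hexc : ∃ i, ω.2.firstHitG ≤ i ∧ i < ω.2.arcs.length ∧ ω.2.nth (i + 1) = (rootS w).side .E) :
    ω.2.kindsIn (rootS w) = [.corner, .corner] := by
  have hF := ω.fh_lt h
  have hfcF : ω.2.fc ω.2.firstHitG = farW w := (fc_fh ω hr h).1
  set F := ω.2.firstHitG with hFdef
  set n := ω.2.arcs.length with hndef
  -- the prefix arc in `rootS w` with an `N` end
  obtain ⟨i₀, hi₀1, hi₀F, hnth₀⟩ := hpre
  have hm : ∃ m, m < F ∧ ω.2.fc m = rootS w ∧ (ω.2.sIn m = .N ∨ ω.2.sOut m = .N) := by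
    obtain ⟨hin, -, -⟩ := ω.2.side_sIn_nth (i := i₀) (by omega)
    obtain ⟨-, hout, -⟩ := ω.2.side_sIn_nth (i := i₀ - 1) (by omega)
    rw [show i₀ - 1 + 1 = i₀ by omega, hnth₀, root_side_S_eq_rootS_side_N] at hout
    rw [hnth₀, root_side_S_eq_rootS_side_N] at hin
    have hfi := face_of_side_eqQ hin
    rw [← root_side_S_eq_rootS_side_N, root_side_S_faces] at hfi
    simp only at hfi
    rcases hfi with e | e
    · exact ⟨i₀, hi₀F, e, Or.inl (Face.side_injective (rootS w) (by rw [e] at hin; exact hin))⟩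
    · have hfi' := face_of_side_eqQ hout
      rw [← root_side_S_eq_rootS_side_N, root_side_S_faces] at hfi'
      simp only at hfi'
      have hsucc : ω.2.fc (i₀ - 1) ≠ ω.2.fc (i₀ - 1 + 1) := YBWalk.fc_succ_ne (by omega)
      rw [show i₀ - 1 + 1 = i₀ by omega, e] at hsucc
      rcases hfi' with e' | e'
      · exact ⟨i₀ - 1, by omega, e', Or.inr (Face.side_injective (rootS w) (by rw [e'] at hout; exact hout))⟩
      · exact absurd e' hsucc
  obtain ⟨m, hmF, hfm, hmN⟩ := hm
  -- the excursion arc in `rootS w` with an `E` end: one of the arcs `i`, `i + 1` at the crossing of `rootS.E`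
  obtain ⟨i, hFi, hin', hnth'⟩ := hexc
  have hi1 : i + 1 < n := by
    rcases Nat.lt_or_ge (i + 1) n with hl | hl
    · exact hl
    · exfalso
      have e : i + 1 = n := by omega
      rw [e, ω.2.nth_length] at hnth'
      exact farW_side_ne_rootS_side w ω.1 .E hnth'
  obtain ⟨-, hout_i, -⟩ := ω.2.side_sIn_nth (i := i) (by omega)
  obtain ⟨hin_i1, -, -⟩ := ω.2.side_sIn_nth (i := i + 1) hi1
  rw [hnth'] at hout_i hin_i1
  have hfi := face_of_side_eqQ hout_i
  have hfi1 := face_of_side_eqQ hin_i1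
  rw [rootS_side_E_faces_pocketSE] at hfi hfi1
  simp only at hfi hfi1
  have hsucc : ω.2.fc i ≠ ω.2.fc (i + 1) := YBWalk.fc_succ_ne hi1
  have hR : ∃ k', F < k' ∧ k' < n ∧ ω.2.fc k' = rootS w ∧ (ω.2.sIn k' = .E ∨ ω.2.sOut k' = .E) := by
    rcases hfi with e0 | e0
    · refine ⟨i, ?_, by omega, e0, Or.inr (Face.side_injective (rootS w) (by rw [e0] at hout_i; exact hout_i))⟩
      rcases Nat.lt_or_ge F i with hl | hl
      · exact hl
      · exfalso
        have eF : i = F := by omega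
        rw [eF, hfcF] at e0
        exact rootS_ne_farW w e0.symm
    · rcases hfi1 with e1 | e1
      · exact ⟨i + 1, by omega, hi1, e1, Or.inl (Face.side_injective (rootS w) (by rw [e1] at hin_i1; exact hin_i1))⟩
      · exact absurd (e0.trans e1.symm) hsucc
  obtain ⟨k', hFk', hk'n, hfk', hE'⟩ := hR
  have hf : ω.2.fc k' = ω.2.fc m := hfk'.trans hfm.symm
  obtain ⟨hopp, d1, d2, d3, d4⟩ := YBWalk.not_straight_of_two_arcs (γ := ω.2) (i := m) (i' := k') (by omega) hk'n
    (by omega) hf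
  obtain ⟨hopp', -, -, -, -⟩ := YBWalk.not_straight_of_two_arcs (γ := ω.2) (i := k') (i' := m) hk'n (by omega)
    (by omega) hf.symm
  have hxy := (ω.2.side_sIn_nth (i := m) (by omega)).2.2
  have hst := (ω.2.side_sIn_nth hk'n).2.2
  obtain ⟨c1, c2⟩ := corner_corner_of_N_of_E' hxy hopp hst hopp' d1 d2 d3 d4 hmN hE'
  rw [← hfm]
  exact ω.2.kindsIn_eq_corner_corner (m := m) (m' := k') (by omega) hk'n (by omega) hf c1 c2

/-! ## §5 The east pair of the corner-kill table at every boundary position -/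

/-- ★★★ **THE DICHOTOMY FOR A WOUND UNDER-WALK, QUADRANT FORM.** Hole, `K_S1 = (w.1 + 1, w.2 − 2)` absent and no western
door of the column `w.1 + 1` below the kill row (`(w.1, y)` or `(w.1 + 1, y)` absent for `y ≤ w.2 − 3` — vacuous when the
kill cell is on the bottom boundary): a class-`B2a` under-walk at the far cell whose excursion polygon winds around the
root doubles `w` or `rootS w` through the two `θ`-corners. NOTHING is assumed east of column `w.1 + 1`.
[cite: GlazmanManolescu2019, §1, Fig. 1 (two arcs at the two θ-corners weigh w₁)]
[cite: CourantRobbins1958, Ch. V Appendix §2 (The Jordan Curve Theorem for Polygons: the even–odd rule)]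
[cite: Glazman2015WeightedSAW, Lemma 3.1 (proof, pp. 6–7: the classes of walks through a rhombus)] -/
theorem kindsIn_rootS_or_root_eq_of_AJ_ne_zero_under_quadrant (hh : holeFaceW w ∉ D) (hK : killSE w ∉ D)
    (hcol : ∀ y : ℤ, y ≤ w.2 - 3 → (w.1, y) ∉ D ∨ (w.1 + 1, y) ∉ D)
    (ω : ΩG D (w.side .W) (farW w)) (hr : RootedFace D (w.side .W) (farW w)) (h : ω.IsB2a)
    (hS : ω.2.firstSideG = .S) (hA : ω.AJ hr h (toC (midPt (w.side .W))) ≠ 0) :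
    ω.2.kindsIn (rootS w) = [.corner, .corner] ∨ ω.2.kindsIn w = [.corner, .corner] := by
  have hF := ω.fh_lt h
  rcases ω.cross_root_S_or_exists_nth_eq_rootS_E hK hcol hr h hA with ⟨i, hFi, hin, e⟩ | ⟨i, hFi, hin, e⟩
  · exact Or.inr (ω.kindsIn_root_eq_of_cross_root_S hh hr h ⟨i, hFi, hin, e⟩).2
  · left
    have hi1 : i + 1 < ω.2.arcs.length := by
      rcases Nat.lt_or_ge (i + 1) ω.2.arcs.length with hl | hl
      · exact hl
      · exfalso
        have e' : i + 1 = ω.2.arcs.length := by omega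
        rw [e', ω.2.nth_length] at e
        exact farW_side_ne_rootS_side w ω.1 .E e
    have hFi' : ω.2.firstHitG < i := by
      rcases Nat.lt_or_ge ω.2.firstHitG i with hl | hl
      · exact hl
      · exfalso
        have eF : i = ω.2.firstHitG := by omega
        have e1 : ω.2.nth (ω.2.firstHitG + 1) = (farW w).side (ω.z1 hr h) := (ω.2.exitSide_specG hr hF).1
        rw [eF, e1] at e
        exact farW_side_ne_rootS_side w _ .E e
    have hJ : ∃ j, j < ω.Mv ∧ (ω.jFace h j).side (ω.jOut hr h j) = (rootS w).side .E := by
      refine ⟨i - ω.2.firstHitG, by unfold ΩG.Mv; omega, ?_⟩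
      rw [side_jOut (hr := hr) h (by unfold ΩG.Mv; omega),
        show ω.2.firstHitG + (i - ω.2.firstHitG) + 1 = i + 1 by omega, e]
    obtain ⟨i₀, hi₀1, hi₀F, hnth₀⟩ := exists_prefix_nth_eq_root_S_of_cross_rootS_E hh hr ω h hS hJ
    exact kindsIn_rootS_eq_of_prefix_cross_of_cross_rootS_E ω hr h ⟨i₀, hi₀1, hi₀F, hnth₀⟩ ⟨i, hFi, hin, e⟩

/-- ★★★★ **THE STRUCTURAL `K_S1` KILL, QUADRANT FORM**: hole, kill cell, no western door of column `w.1 + 1` below the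
kill row ⇒ every WOUND class-`B2a` UNDER-walk at the far cell is NOT `w₁`-free off the far cell (either orientation of
the winding witness). [cite: GlazmanManolescu2019, §1, Fig. 1 and the remark after eq. (1) («w₁ = 0 at θ = 2π/3»)]
[cite: CourantRobbins1958, Ch. V Appendix §2 (the even–odd rule)] [cite: Glazman2015WeightedSAW, Lemma 3.1 (proof, pp. 6–7)] -/
theorem not_W1FreeOff_farW_of_wound_under_quadrant (hh : holeFaceW w ∉ D) (hK : killSE w ∉ D)
    (hcol : ∀ y : ℤ, y ≤ w.2 - 3 → (w.1, y) ∉ D ∨ (w.1 + 1, y) ∉ D)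
    (ω : ΩG D (w.side .W) (farW w)) (hr : RootedFace D (w.side .W) (farW w)) (h : ω.IsB2a)
    (hS : ω.2.firstSideG = .S) {θ : ℝ}
    (hW : ω.WE (fun _ => θ) ≠ excursionWinding θ ω.2.firstSideG (ω.z1 hr h) ω.1) : ¬ω.2.W1FreeOff (farW w) := by
  have key : ω.2.kindsIn (rootS w) = [.corner, .corner] ∨ ω.2.kindsIn w = [.corner, .corner] := by
    rcases ω.AJ_ne_zero_or_rev_of_wound hr h θ hW with hA | hA
    · exact kindsIn_rootS_or_root_eq_of_AJ_ne_zero_under_quadrant hh hK hcol ω hr h hS hA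
    · have h' := ω.rev_isB2a hr h
      have hS' : (ω.rev hr).2.firstSideG = .S := by rw [ω.rev_firstSide hr h]; exact hS
      have perm : ∀ {g : Face}, g ≠ farW w → (ω.rev hr).2.kindsIn g = [.corner, .corner] →
          ω.2.kindsIn g = [.corner, .corner] := by
        intro g hg hk
        have hperm := ω.kindsIn_rev_perm hr h hg
        rw [hk] at hperm
        have hp : (ω.2.kindsIn g).Perm (List.replicate 2 .corner) := hperm.symm
        exact List.perm_replicate.1 hp
      rcases kindsIn_rootS_or_root_eq_of_AJ_ne_zero_under_quadrant hh hK hcol (ω.rev hr) hr h' hS' hA with hk | hk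
      · exact Or.inl (perm (rootS_ne_farW w) hk)
      · exact Or.inr (perm (root_ne_farW w) hk)
  intro hfree
  rcases key with hk | hk
  · have hmem : rootS w ∈ ω.2.facesVisited := by
      by_contra hn
      rw [YBWalk.kindsIn_eq_nil hn] at hk
      exact List.cons_ne_nil _ _ hk.symm
    exact hfree _ hmem (rootS_ne_farW w) hk
  · have hmem : w ∈ ω.2.facesVisited := by
      by_contra hn
      rw [YBWalk.kindsIn_eq_nil hn] at hk
      exact List.cons_ne_nil _ _ hk.symm
    exact hfree _ hmem (root_ne_farW w) hk

/-- ★★★★ The companion files' hypothesis `hS₁` («every wound under-walk is `w₁`-marked off the far cell»), QUADRANT FORM —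
for the kill cell `K_S1` at ANY bottom-boundary position (nothing east of column `w.1 + 1`).
[cite: GlazmanManolescu2019, §1, remark after eq. (1)] [cite: CourantRobbins1958, Ch. V Appendix §2 (the even–odd rule)] -/
theorem under_w1_killed_of_killSE_quadrant (hh : holeFaceW w ∉ D) (hK : killSE w ∉ D)
    (hcol : ∀ y : ℤ, y ≤ w.2 - 3 → (w.1, y) ∉ D ∨ (w.1 + 1, y) ∉ D)
    (hr : RootedFace D (w.side .W) (farW w)) (θ : ℝ) :
    ∀ (ω : ΩG D (w.side .W) (farW w)) (h : ω.IsB2a), ω.2.firstSideG = .S →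
      ω.WE (fun _ => θ) ≠ excursionWinding θ ω.2.firstSideG (ω.z1 hr h) ω.1 → ¬ω.2.W1FreeOff (farW w) :=
  fun ω h hS hW => not_W1FreeOff_farW_of_wound_under_quadrant hh hK hcol ω hr h hS hW

/-- The reflection carries the cells of column `w.1` / `w.1 + 1` below the root row to those above it.
[cite: GlazmanManolescu2019, §4.2 (lattice symmetries)] -/
private theorem mirrorRowFace_mkQ (w : Face) (x y : ℤ) : mirrorRowFace w.2 ((x, y) : Face) = (x, 2 * w.2 - y) := by
  simp [mirrorRowFace]

/-- ★★★★ **THE STRUCTURAL `K_N2` KILL, QUADRANT FORM** (row-mirror twin): hole, `K_N2 = (w.1 + 1, w.2 + 2)` absent, no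
western door of column `w.1 + 1` above the kill row (`(w.1, y)` or `(w.1 + 1, y)` absent for `y ≥ w.2 + 3`) ⇒ every wound
class-`B2a` OVER-walk at the far cell is NOT `w₂`-free off the far cell. Transport through the parent's reflection
`ΩG.mirrorFar`. [cite: GlazmanManolescu2019, §1, Fig. 1 and the paragraph of Fig. 2 («if θ = π/3, then w₂ = 0»)]
[cite: CourantRobbins1958, Ch. V Appendix §2 (the even–odd rule)] [cite: Glazman2015WeightedSAW, Lemma 3.1 (proof, pp. 6–7)] -/
theorem not_W2FreeOff_farW_of_wound_over_quadrant (hh : holeFaceW w ∉ D) (hK : killNE w ∉ D)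
    (hcol : ∀ y : ℤ, w.2 + 3 ≤ y → (w.1, y) ∉ D ∨ (w.1 + 1, y) ∉ D)
    (ω : ΩG D (w.side .W) (farW w)) (hr : RootedFace D (w.side .W) (farW w)) (h : ω.IsB2a)
    (hN : ω.2.firstSideG = .N) {θ : ℝ}
    (hW : ω.WE (fun _ => θ) ≠ excursionWinding θ ω.2.firstSideG (ω.z1 hr h) ω.1) : ¬ω.2.W2FreeOff (farW w) := by
  have hr' := rootedFace_rowMirrorDom w hr
  have h' := ω.mirrorFar_isB2a hr h
  have hh' : holeFaceW w ∉ rowMirrorDom w D := by rwa [mem_rowMirrorDom, mirrorRowFace_holeFaceW]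
  have hK' : killSE w ∉ rowMirrorDom w D := by rwa [mem_rowMirrorDom, mirrorRowFace_killSE]
  have hcol' : ∀ y : ℤ, y ≤ w.2 - 3 → (w.1, y) ∉ rowMirrorDom w D ∨ (w.1 + 1, y) ∉ rowMirrorDom w D := by
    intro y hy
    rw [mem_rowMirrorDom, mem_rowMirrorDom, mirrorRowFace_mkQ, mirrorRowFace_mkQ]
    exact hcol (2 * w.2 - y) (by omega)
  have hS' : ω.mirrorFar.2.firstSideG = .S := by rw [ω.mirrorFar_firstSideG, hN]; rfl
  have hkill := not_W1FreeOff_farW_of_wound_under_quadrant hh' hK' hcol' ω.mirrorFar hr' h' hS'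
    (ω.mirrorFar_wound hr h hW)
  intro hfree
  apply hkill
  intro g hg hgf hk
  have hk2 := ω.kindsIn_eq_coCorner_of_mirrorFar_corner hk
  have hmem : mirrorRowFace w.2 g ∈ ω.2.facesVisited := by
    by_contra hn
    rw [YBWalk.kindsIn_eq_nil hn] at hk2
    exact List.cons_ne_nil _ _ hk2.symm
  have hne : mirrorRowFace w.2 g ≠ farW w := by
    intro e
    apply hgf
    have e' := congrArg (mirrorRowFace w.2) e
    rw [mirrorRowFace_mirrorRowFace, mirrorRowFace_farW] at e'
    exact e'
  exact hfree _ hmem hne hk2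

/-- ★★★★ The companion files' hypothesis `hN₂` («every wound over-walk is `w₂`-marked off the far cell»), QUADRANT FORM.
[cite: GlazmanManolescu2019, §1 (the paragraph of Fig. 2)] [cite: CourantRobbins1958, Ch. V Appendix §2 (the even–odd rule)] -/
theorem over_w2_killed_of_killNE_quadrant (hh : holeFaceW w ∉ D) (hK : killNE w ∉ D)
    (hcol : ∀ y : ℤ, w.2 + 3 ≤ y → (w.1, y) ∉ D ∨ (w.1 + 1, y) ∉ D)
    (hr : RootedFace D (w.side .W) (farW w)) (θ : ℝ) :
    ∀ (ω : ΩG D (w.side .W) (farW w)) (h : ω.IsB2a), ω.2.firstSideG = .N →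
      ω.WE (fun _ => θ) ≠ excursionWinding θ ω.2.firstSideG (ω.z1 hr h) ω.1 → ¬ω.2.W2FreeOff (farW w) :=
  fun ω h hN hW => not_W2FreeOff_farW_of_wound_over_quadrant hh hK hcol ω hr h hN hW

end ΩG

end Literature.Probability.RandomPlanarGeometry.SAW.YangBaxter

namespace Literature.Barriers.CriticalPhenomena.PlaquetteWalk

open Literature.Probability.RandomPlanarGeometry.SAW.YangBaxter
open Real Complex

/-- ★★★★ **THE EASTERN KILL-FORCED ZERO, QUADRANT FORM** — the east pair of the corner-kill table at every boundary
position: hole, the two eastern kill cells `(w.1 + 1, w.2 ± 2)` absent, no western door of column `w.1 + 1` below the lower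
kill row nor above the upper one (both vacuous in a box whose hole sits two rows from the bottom and from the top), ONE
`w₂`-free wound under-walk and ONE `w₁`-free wound over-walk ⇒ an exact zero of the Yang–Baxter vertex functional in
`(π/3, 2π/3)` — with NOTHING assumed east of column `w.1 + 1` (boxes of any width).
[cite: GlazmanManolescu2019, Lemma 2.1 (statement, "in the form given in [Gl]")]
[cite: GlazmanManolescu2019, §1 (the paragraph of Fig. 2 and the remark after eq. (1))]
[cite: Glazman2015WeightedSAW, Lemma 3.1 (proof, pp. 6–7)] [cite: DuminilCopinSmirnov2012, proof of Lemma 1]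
[cite: CourantRobbins1958, Ch. V Appendix §2 (The Jordan Curve Theorem for Polygons: the even–odd rule)] -/
theorem vertexFunctional_printed_farCellW_exists_eq_zero_Ioo_of_east_kills_quadrant (Dl : List Face) (w : Face)
    (hf : farW w ∈ Dl) (hh : holeFaceW w ∉ dom Dl) (hr : RootedFace (dom Dl) (w.side .W) (farW w))
    (hKN : killNE w ∉ dom Dl) (hcolN : ∀ y : ℤ, w.2 + 3 ≤ y → (w.1, y) ∉ dom Dl ∨ (w.1 + 1, y) ∉ dom Dl)
    (hKS : killSE w ∉ dom Dl) (hcolS : ∀ y : ℤ, y ≤ w.2 - 3 → (w.1, y) ∉ dom Dl ∨ (w.1 + 1, y) ∉ dom Dl)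
    (hS₂ : ∃ (ω : ΩG (dom Dl) (w.side .W) (farW w)) (h : ω.IsB2a), ω.2.firstSideG = .S ∧
      ω.WE (fun _ => π / 3) ≠ excursionWinding (π / 3) ω.2.firstSideG (ω.z1 hr h) ω.1 ∧ ω.2.W2FreeOff (farW w))
    (hN₁ : ∃ (ω : ΩG (dom Dl) (w.side .W) (farW w)) (h : ω.IsB2a), ω.2.firstSideG = .N ∧
      ω.WE (fun _ => 2 * π / 3) ≠ excursionWinding (2 * π / 3) ω.2.firstSideG (ω.z1 hr h) ω.1 ∧
        ω.2.W1FreeOff (farW w)) :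
    ∃ θ ∈ Set.Ioo (π / 3) (2 * π / 3),
      vertexFunctional (printedWeights θ) tFiveEighths (ybCoeff θ) Dl (w.side .W) (farW w) = 0 :=
  vertexFunctional_printed_farCellW_exists_eq_zero_Ioo_of_opposite_kills' Dl w hf hh hr
    (ΩG.over_w2_killed_of_killNE_quadrant hh hKN hcolN hr (π / 3)) hS₂
    (ΩG.under_w1_killed_of_killSE_quadrant hh hKS hcolS hr (2 * π / 3)) hN₁

/-! ## §6 A closed instance in a box WIDER than the kill column: `7×5 ∖ {(3,2),(5,0),(5,4),(0,0)}` -/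

/-- The venture lane's frame `75a` made asymmetric: `7×5 ∖ {(3,2),(5,0),(5,4),(0,0)}` (31 faces) — root plaquette `(4,2)`,
hole `(3,2)`, far cell `(2,2)`, eastern kill cells `(5,0)`, `(5,4)` on the bottom/top walls with the column `6` PRESENT east
of them (so the east-wall form of `PlaquetteWalkHoleRootPrefixLoop` does not apply), `(0,0)` removed to break the row
symmetry. [cite: GlazmanManolescu2019, §2.1 (finite domains of faces)] -/
def wideEastKillDom : List Face :=
  [(0,1),(0,2),(0,3),(0,4),(1,0),(1,1),(1,2),(1,3),(1,4),(2,0),(2,1),(2,2),(2,3),(2,4),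
   (3,0),(3,1),(3,3),(3,4),(4,0),(4,1),(4,2),(4,3),(4,4),(5,1),(5,2),(5,3),(6,0),(6,1),(6,2),(6,3),(6,4)]

/-- The under witness of `PlaquetteWalkHoleRootKillForcedZeroWitness`, redrawn in the wide domain. [cite: GlazmanManolescu2019, §1 (definition of the model), Fig. 1] -/
def wideUnder : YBWalk (dom wideEastKillDom) (w42.side .W) ((farW w42).side .N) where
  mids := underMids
  head_eq := by decide
  getLast_eq := by decide
  nodup := by decide
  arc_mem := arc_mem_of_check (by decide)
  isChain := by decide
  noncross := noncross_of_check (by decide)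

/-- The over witness, redrawn in the wide domain. [cite: GlazmanManolescu2019, §1 (definition of the model), Fig. 1] -/
def wideOver : YBWalk (dom wideEastKillDom) (w42.side .W) ((farW w42).side .S) where
  mids := overMids
  head_eq := by decide
  getLast_eq := by decide
  nodup := by decide
  arc_mem := arc_mem_of_check (by decide)
  isChain := by decide
  noncross := noncross_of_check (by decide)

/-- The wide under witness, labelled. [cite: Glazman2015WeightedSAW, Lemma 3.1 (proof, pp. 6–7: the classes of walks through a rhombus)] -/
def ωWU : ΩG (dom wideEastKillDom) (w42.side .W) (farW w42) := ⟨.N, wideUnder⟩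

/-- The wide over witness, labelled. [cite: Glazman2015WeightedSAW, Lemma 3.1 (proof, pp. 6–7: the classes of walks through a rhombus)] -/
def ωWO : ΩG (dom wideEastKillDom) (w42.side .W) (farW w42) := ⟨.S, wideOver⟩

/-- The far cell is rooted in the wide domain. [cite: GlazmanManolescu2019, §2.1 (walks start on the boundary of the domain)] -/
theorem rootedFace_wideEastKillDom : RootedFace (dom wideEastKillDom) (w42.side .W) (farW w42) :=
  ⟨show farW w42 ∈ wideEastKillDom by decide,
    show ¬((w42.side .W).faces.1 ∈ wideEastKillDom ∧ (w42.side .W).faces.2 ∈ wideEastKillDom) by decide⟩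

/-- First hit of the wide under witness. [cite: Glazman2015WeightedSAW, Lemma 3.1 (proof, pp. 6–7: the first crossing of ∂r)] -/
theorem ωWU_firstHitG : ωWU.2.firstHitG = 4 := by decide

/-- Length of the wide under witness. [folklore] -/
private theorem ωWU_length : ωWU.2.arcs.length = 18 := by decide

/-- The wide under witness is of class `B2a`. [cite: Glazman2015WeightedSAW, Lemma 3.1 (proof, pp. 6–7: the classes of walks through a rhombus)] -/
theorem ωWU_isB2a : ωWU.IsB2a := by
  refine ΩG.isB2a_of_forall_fc_ne (by rw [ωWU_firstHitG, ωWU_length]; omega) fun j hj1 hj2 => ?_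
  rw [ωWU_firstHitG] at hj1
  rw [ωWU_length] at hj2
  have key : ∀ j < 18, 4 < j → ωWU.2.fc j ≠ farW w42 := by decide
  exact key j hj2 hj1

/-- The wide under witness is an under-walk. [cite: Glazman2015WeightedSAW, Lemma 3.1 (proof, pp. 6–7)] -/
theorem ωWU_firstSideG : ωWU.2.firstSideG = .S :=
  ΩG.firstSideG_eq_of_nth ωWU (by rw [ωWU_firstHitG]; decide)

/-- The wide under witness is `w₂`-free off the far cell. [cite: GlazmanManolescu2019, §1 (the paragraph of Fig. 2: «if θ = π/3, then w₂ = 0»)] -/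
theorem ωWU_W2FreeOff : ωWU.2.W2FreeOff (farW w42) := by
  unfold YBWalk.W2FreeOff; decide

/-- The wide under witness is wound. [cite: CourantRobbins1958, Ch. V Appendix §2 (the even–odd rule)] [cite: GlazmanManolescu2019, Lemma 2.1] -/
theorem ωWU_wound (θ : ℝ) :
    ωWU.WE (fun _ => θ) ≠ excursionWinding θ ωWU.2.firstSideG (ωWU.z1 rootedFace_wideEastKillDom ωWU_isB2a) ωWU.1 := by
  refine ΩG.WE_ne_excursionWinding_of_odd_card ωWU rootedFace_wideEastKillDom ωWU_isB2a ?_ θ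
  have hM : ωWU.Mv = 14 := by unfold ΩG.Mv; rw [ωWU_firstHitG, ωWU_length]
  rw [hM, ωWU_firstHitG]
  decide

/-- First hit of the wide over witness. [cite: Glazman2015WeightedSAW, Lemma 3.1 (proof, pp. 6–7: the first crossing of ∂r)] -/
theorem ωWO_firstHitG : ωWO.2.firstHitG = 4 := by decide

/-- Length of the wide over witness. [folklore] -/
private theorem ωWO_length : ωWO.2.arcs.length = 18 := by decide

/-- The wide over witness is of class `B2a`. [cite: Glazman2015WeightedSAW, Lemma 3.1 (proof, pp. 6–7: the classes of walks through a rhombus)] -/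
theorem ωWO_isB2a : ωWO.IsB2a := by
  refine ΩG.isB2a_of_forall_fc_ne (by rw [ωWO_firstHitG, ωWO_length]; omega) fun j hj1 hj2 => ?_
  rw [ωWO_firstHitG] at hj1
  rw [ωWO_length] at hj2
  have key : ∀ j < 18, 4 < j → ωWO.2.fc j ≠ farW w42 := by decide
  exact key j hj2 hj1

/-- The wide over witness is an over-walk. [cite: Glazman2015WeightedSAW, Lemma 3.1 (proof, pp. 6–7)] -/
theorem ωWO_firstSideG : ωWO.2.firstSideG = .N :=
  ΩG.firstSideG_eq_of_nth ωWO (by rw [ωWO_firstHitG]; decide)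

/-- The wide over witness is `w₁`-free off the far cell. [cite: GlazmanManolescu2019, §1, remark after eq. (1) («w₁ = 0 at θ = 2π/3»)] -/
theorem ωWO_W1FreeOff : ωWO.2.W1FreeOff (farW w42) := by
  unfold YBWalk.W1FreeOff; decide

/-- The wide over witness is wound. [cite: CourantRobbins1958, Ch. V Appendix §2 (the even–odd rule)] [cite: GlazmanManolescu2019, Lemma 2.1] -/
theorem ωWO_wound (θ : ℝ) :
    ωWO.WE (fun _ => θ) ≠ excursionWinding θ ωWO.2.firstSideG (ωWO.z1 rootedFace_wideEastKillDom ωWO_isB2a) ωWO.1 := by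
  refine ΩG.WE_ne_excursionWinding_of_odd_card ωWO rootedFace_wideEastKillDom ωWO_isB2a ?_ θ
  have hM : ωWO.Mv = 14 := by unfold ΩG.Mv; rw [ωWO_firstHitG, ωWO_length]
  rw [hM, ωWO_firstHitG]
  decide

/-- ★★★★ **A CLOSED KILL-FORCED ZERO IN A BOX WIDER THAN THE KILL COLUMN.** On `7×5 ∖ {(3,2),(5,0),(5,4),(0,0)}` rooted
at the `W` side of `(4,2)` — the eastern kill cells sit on the bottom and top walls with a live column east of them —
the Yang–Baxter vertex functional of the printed weights at the far cell `(2,2)` has an exact zero in `(π/3, 2π/3)`: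
the quadrant form of this file (both column conditions vacuous: the rows `≤ −1` and `≥ 5` are outside the box) with
the kernel-certified witnesses above. No hypothesis. [cite: GlazmanManolescu2019, Lemma 2.1 (statement, "in the form given in [Gl]")]
[cite: GlazmanManolescu2019, §1 (the paragraph of Fig. 2 and the remark after eq. (1))]
[cite: Glazman2015WeightedSAW, Lemma 3.1 (proof, pp. 6–7)] [cite: DuminilCopinSmirnov2012, proof of Lemma 1]
[cite: CourantRobbins1958, Ch. V Appendix §2 (The Jordan Curve Theorem for Polygons: the even–odd rule)] -/
theorem vertexFunctional_printed_wideEastKillDom_exists_eq_zero :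
    ∃ θ ∈ Set.Ioo (π / 3) (2 * π / 3),
      vertexFunctional (printedWeights θ) tFiveEighths (ybCoeff θ) wideEastKillDom (w42.side .W) (farW w42) = 0 :=
  vertexFunctional_printed_farCellW_exists_eq_zero_Ioo_of_east_kills_quadrant wideEastKillDom w42
    (show farW w42 ∈ wideEastKillDom by decide) (show holeFaceW w42 ∉ wideEastKillDom by decide)
    rootedFace_wideEastKillDom (show killNE w42 ∉ wideEastKillDom by decide)
    (fun y hy => Or.inl (show (w42.1, y) ∉ wideEastKillDom by
      simp only [w42] at hy ⊢
      simp only [wideEastKillDom, List.mem_cons, Prod.mk.injEq, List.not_mem_nil, or_false, not_or, not_and]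
      omega))
    (show killSE w42 ∉ wideEastKillDom by decide)
    (fun y hy => Or.inl (show (w42.1, y) ∉ wideEastKillDom by
      simp only [w42] at hy ⊢
      simp only [wideEastKillDom, List.mem_cons, Prod.mk.injEq, List.not_mem_nil, or_false, not_or, not_and]
      omega))
    ⟨ωWU, ωWU_isB2a, ωWU_firstSideG, ωWU_wound _, ωWU_W2FreeOff⟩ ⟨ωWO, ωWO_isB2a, ωWO_firstSideG, ωWO_wound _, ωWO_W1FreeOff⟩

end Literature.Barriers.CriticalPhenomena.PlaquetteWalk
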